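import Summits.ResolutionOfSingularities.ResolutionOfSingularities.Theorems.PAlterationPialtFrobenius
import Summits.ResolutionOfSingularities.ResolutionOfSingularities.Theorems.PAlterationPialtRadicialCover
import Summits.ResolutionOfSingularities.ResolutionOfSingularities.Theorems.PAlterationPicoverToRadicialBottomReducedPullbackTransfer
import Summits.ResolutionOfSingularities.ResolutionOfSingularities.Theorems.PAlterationAssemblyReduction
import Literature.AlgebraicGeometry.Resolution.ResolutionGlue
import HarnessLib

/-!
# `Pialt` (crux stmt-ResolutionOfSingularities-0555), line `SketchIdeator2` / Card A: the reordering lemma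

Stub `stub_reordering` of the lead's skeleton `radicially-regular-endgame` (helper file,
`--supports stmt-ResolutionOfSingularities-0555`; does not close the item).

**Statement.** Over a perfect field `k` of characteristic `p`, a NORMAL integral separated `X` of
finite type satisfying the conclusion of the crux (a proper surjective `g : X' → X` from an
integral regular `X'`, finite and universally injective over a dense open) has a RADICIALLY
REGULAR MODIFICATION: a proper birational `π : Z → X` with `Z` integral, together with a finite,
universally injective, surjective `W → Z` from an integral regular `W`.

**Proof** (modification first, one finite radicial cover last).
1. Relative normalisation of `X` in the alteration
   (`exists_radicialCover_hasResolution_of_pialtConclusion`): a finite, universally injective,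
   surjective `h'' : X'' → X` with `X''` integral and admitting a resolution `ρ : W₀ → X''`.
2. Frobenius domination (`exists_frobeniusCover_of_finite_universallyInjective`, `X` normal, `k`
   perfect): an integral `N ≅ X` with a finite, universally injective, surjective `ψ : N → X''`.
3. The reduced fibre product `Z := (N ×_{X''} W₀)_red` is integral (`isIntegral_reduced_pullback`),
   `Z → N` is proper and birational (`stub_reducedPullbackTransfer`), and `Z → W₀` is finite,
   universally injective and surjective.
4. Frobenius domination again, now for `Z → W₀` over the regular (hence normal) `W₀`: an integral
   `N' ≅ W₀` — hence regular — with a finite, universally injective, surjective `N' → Z`.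
5. `π := (Z → N) ≫ (N ≅ X)` is proper and birational (`IsBirational.comp_iso`).
-/

set_option linter.dupNamespace false -- mandated namespace of this single-conjunct summit

noncomputable section

open CategoryTheory CategoryTheory.Limits AlgebraicGeometry TopologicalSpace
open Literature.AlgebraicGeometry.Resolution
open Scheme.IdealSheafData

namespace Summit.ResolutionOfSingularities.ResolutionOfSingularities.Theorems.Pialt.RadiciallyRegular

/-- **The reordering lemma.** Over a perfect field `k` of characteristic `p`, a NORMAL integral
separated `X` of finite type satisfying the conclusion of the crux has a RADICIALLY REGULAR
MODIFICATION: `π : Z → X` proper birational, `Z` integral, and a finite, universally injective,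
surjective `W → Z` from an integral regular `W`. (Relative normalisation `X'' → X` of `X` in the
alteration + Frobenius domination `X ≅ N → X''` + reduced pull-back of a resolution `W₀ → X''`
along `N → X''` + Frobenius domination of `Z → W₀`.) [cite: Temkin2013, Rem. 1.3.5(i)] -/
theorem stub_reordering (p : ℕ) (hp : p.Prime) (k : Type) [Field k] [CharP k p] [PerfectField k]
    (X : Scheme.{0}) (f : X ⟶ Spec (.of k)) [IsSeparated f] [LocallyOfFiniteType f]
    [QuasiCompact f] [IsIntegral X] (hN : ∀ x : X, IsIntegrallyClosed (X.presheaf.stalk x))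
    (h : ∃ (X' : Scheme.{0}) (g : X' ⟶ X), IsProper g ∧ IsIntegral X' ∧ Scheme.IsRegular X' ∧
      Function.Surjective g.base ∧ ∃ U : X.Opens, Dense (U : Set X) ∧ IsFinite (g ∣_ U) ∧
        UniversallyInjective (g ∣_ U)) :
    ∃ (Z : Scheme.{0}) (π : Z ⟶ X), IsProper π ∧ IsBirational π ∧ IsIntegral Z ∧
      ∃ (W : Scheme.{0}) (h : W ⟶ Z), IsIntegral W ∧ Scheme.IsRegular W ∧ IsFinite h ∧
        UniversallyInjective h ∧ Function.Surjective h.base := by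
  -- 1. the relative normalisation `h'' : X'' → X` of `X` in the alteration
  obtain ⟨X'', h'', hint'', hfin'', hui'', hsurj'', hres''⟩ :=
    exists_radicialCover_hasResolution_of_pialtConclusion hp k X f hN h
  haveI := hint''; haveI := hfin''; haveI := hui''
  haveI : IsDominant h'' := ⟨hsurj''.denseRange⟩
  -- 2. Frobenius domination `X ≅ N → X''`
  obtain ⟨N, ψ, φ, hintN, hφ, hψfin, hψui, hψsurj⟩ :=
    exists_frobeniusCover_of_finite_universallyInjective hp k X'' X f h'' hN
  haveI := hintN; haveI := hφ; haveI := hψfin; haveI := hψui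
  haveI : Surjective ψ := ⟨hψsurj⟩
  -- 3. a resolution `ρ : W₀ → X''` and the reduced fibre product `Z := (N ×_{X''} W₀)_red`
  obtain ⟨W₀, ρ, hρ⟩ := hres''
  haveI : IsProper ρ := hρ.isProper
  haveI : IsReduced W₀ := hρ.isRegular.isReduced
  haveI : IsIntegral W₀ := hρ.isBirational.isIntegral
  haveI hZint : IsIntegral (vanishingIdeal (⊤ : Closeds ↑(pullback ψ ρ))).subscheme :=
    isIntegral_reduced_pullback ψ ρ
  have hbir : IsBirational
      ((vanishingIdeal (⊤ : Closeds ↑(pullback ψ ρ))).subschemeι ≫ pullback.fst ψ ρ) :=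
    stub_reducedPullbackTransfer N X'' W₀ ψ ρ hρ.isBirational
  haveI hfin₂ : IsFinite
      ((vanishingIdeal (⊤ : Closeds ↑(pullback ψ ρ))).subschemeι ≫ pullback.snd ψ ρ) :=
    isFinite_reduced_pullback_snd ψ ρ
  haveI hui₂ : UniversallyInjective
      ((vanishingIdeal (⊤ : Closeds ↑(pullback ψ ρ))).subschemeι ≫ pullback.snd ψ ρ) :=
    universallyInjective_reduced_pullback_snd ψ ρ
  have hsurj₂ : Surjective
      ((vanishingIdeal (⊤ : Closeds ↑(pullback ψ ρ))).subschemeι ≫ pullback.snd ψ ρ) :=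
    surjective_reduced_pullback_snd ψ ρ
  haveI : IsDominant
      ((vanishingIdeal (⊤ : Closeds ↑(pullback ψ ρ))).subschemeι ≫ pullback.snd ψ ρ) :=
    ⟨hsurj₂.surj.denseRange⟩
  -- 4. Frobenius domination of `Z → W₀` over the regular, hence normal, `W₀`
  haveI : LocallyOfFiniteType (ρ ≫ h'' ≫ f) := inferInstance
  have hW₀n : ∀ w : W₀, IsIntegrallyClosed (W₀.presheaf.stalk w) := fun w =>
    haveI := hρ.isRegular w
    isIntegrallyClosed_of_isRegularLocalRing (W₀.presheaf.stalk w)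
  obtain ⟨N', ψ', φ', hintN', hφ', hψ'fin, hψ'ui, hψ'surj⟩ :=
    exists_frobeniusCover_of_finite_universallyInjective hp k
      (vanishingIdeal (⊤ : Closeds ↑(pullback ψ ρ))).subscheme W₀ (ρ ≫ h'' ≫ f)
      ((vanishingIdeal (⊤ : Closeds ↑(pullback ψ ρ))).subschemeι ≫ pullback.snd ψ ρ) hW₀n
  haveI := hφ'
  have hregN' : Scheme.IsRegular N' := Scheme.IsRegular.of_iso (inv φ') hρ.isRegular
  -- 5. `π := (Z → N) ≫ (N ≅ X)`
  refine ⟨(vanishingIdeal (⊤ : Closeds ↑(pullback ψ ρ))).subscheme,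
    ((vanishingIdeal (⊤ : Closeds ↑(pullback ψ ρ))).subschemeι ≫ pullback.fst ψ ρ) ≫ φ,
    inferInstance, hbir.comp_iso φ, hZint, N', ψ', hintN', hregN', hψ'fin, hψ'ui, hψ'surj⟩

end Summit.ResolutionOfSingularities.ResolutionOfSingularities.Theorems.Pialt.RadiciallyRegular

end
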